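import Literature.MathematicalPhysics.KineticTheory.LangevinChainGibbs
import Literature.MathematicalPhysics.KineticTheory.LangevinChainNESSProofs
import Literature.Probability.Distributions.GaussianPoincare
import Literature.Probability.Distributions.GaussianPoincareVariance
import Literature.Probability.Distributions.GaussianPiDensity
import Mathlib.Analysis.Calculus.Deriv.Pi
import Mathlib.Analysis.Calculus.Deriv.Shift
import HarnessLib

/-!
# Crux `ExtensiveSnapshotIrreversibility` (stmt-AtomisticToContinuum-9121), line `clausius-budget-sound-window`:
registered sub-goal `oddFibrePoincare` — the FIBREWISE GAUSSIAN POINCARÉ INEQUALITY for the odd part of an observable under a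
Gibbs measure (verbatim the stub `stub_oddFibrePoincare` of the fallback line momentum-fisher-maximum-principle; here it gives
`D(w) = 4‖w_o‖² ≤ 8T Σ_i ‖∂_{p_i} w_o‖²` for the McLennan corrector, i.e. S4 ⟸ extensive odd momentum-sensitivity).

## Content and proof

For an oscillator chain `Q` (arbitrary potentials), `N` sites, a temperature `T > 0`, the Gibbs measure
`μ_T = Q.gibbsMeasure N T = Z⁻¹ e^{-H/T} dq dp` (`H = ∑ p_i²/2 + Φ(q)`) and an observable `f ∈ C¹` with
`∂_{p_i} f ∈ L²(μ_T)`, the odd part `f_o(q,p) = (f(q,p) - f(q,-p))/2` satisfies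

  `∫ f_o² dμ_T ≤ 2T ∑_i ∫ (∂_{p_i} f_o)² dμ_T`,  `∂_{p_i} f_o (x) = (∂_{p_i} f (x) + ∂_{p_i} f (q,-p))/2`.

Proof (all in `ℝ≥0∞`, converted to Bochner integrals at the end): by `lintegral_tilted` and
`H = ∑ p²/2 + Φ` the weight factorises, `e^{-H/T} = e^{-Φ(q)/T} e^{-|p|²/2T}`, and Tonelli reduces the claim to
the momentum fibres: for every `q`,
`∫ f_o(q,p)² e^{-|p|²/2T} dp ≤ 2T ∫ ∑_i (∂_i f_o(q,p))² e^{-|p|²/2T} dp`. On a fibre, `e^{-|p|²/2T} dp` is a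
multiple of the product Gaussian `𝒩(0, T I_N)` (`pi_gaussianReal_eq_smul_withDensity`), `p ↦ f_o(q,p)` is `C¹`
and odd, and for an odd `φ` and the (even) Gaussian `γ`, `∫∫ (φ x - φ y)² dγ dγ = 2 ∫ φ² dγ`
(`lintegral_lintegral_sq_sub_of_odd`), so the interpolation form of the Gaussian Poincaré inequality
`∫∫ (φ x - φ y)² ≤ (π²/4) T ∫ |∇φ|²` (`lintegral_sq_sub_le_pi_gaussianReal`, tree) gives
`∫ φ² dγ ≤ (π²/8) T ∫ |∇φ|² dγ ≤ 2T ∫ |∇φ|² dγ` (`π ≤ 4`). The fibre derivative `∂_i (p ↦ F(q,p))` is the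
coordinate derivative `partialP i F` of `FouriersLaw.lean` (`partialP_eq_fderiv_fibre`), and
`∂_{p_i} f_o = (∂_{p_i} f + ∂_{p_i} f ∘ Θ)/2` by the chain rule through `p ↦ -p` (`partialP_oddPart`). The
`L²` hypothesis on `∂_{p_i} f` and the flip invariance of `μ_T` (`lintegral_comp_flip_gibbsMeasure`) make the
right-hand side finite, which is what the passage from `ℝ≥0∞` to real integrals needs; if `e^{-H/T}` is not
integrable, `μ_T = 0` and both sides vanish. Sources: Gaussian Poincaré inequality (folklore; Pisier's rotation
argument as vendored in `Literature/Probability/Distributions/GaussianPoincare.lean`); the fibrewise use for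
kinetic Gibbs measures is standard (e.g. Villani, *Hypocoercivity*, Mem. AMS 2009, §7).
-/

noncomputable section

namespace Summit.AtomisticToContinuum.FouriersLaw.Theorems.ExtensiveSnapshotIrreversibility.ClausiusBudget

open MeasureTheory Filter Topology ProbabilityTheory
open scoped ENNReal NNReal BigOperators ContDiff
open Literature.MathematicalPhysics.KineticTheory.HeatConduction
open Literature.Probability.Distributions

/-! ### Calculus on the momentum fibres -/

/-- `-(p[i ↦ t]) = (-p)[i ↦ -t]`. [folklore] -/
theorem neg_update_eq {N : ℕ} (p : Fin N → ℝ) (i : Fin N) (t : ℝ) :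
    -Function.update p i t = Function.update (-p) i (-t) := by
  funext j
  by_cases hj : j = i
  · subst hj; simp
  · simp [hj]

/-- On the momentum fibre over `q`, the coordinate derivative `∂_{p_i}` of `FouriersLaw.lean` is the Fréchet
derivative of `p ↦ F(q,p)` in the direction `e_i` (chain rule through `t ↦ p[i ↦ t]`). [folklore] -/
theorem partialP_eq_fderiv_fibre {N : ℕ} (F : PhaseSpace N → ℝ) (q p : Fin N → ℝ) (i : Fin N)
    (h : DifferentiableAt ℝ (fun p' : Fin N → ℝ => F (q, p')) p) :
    partialP i F (q, p) = fderiv ℝ (fun p' : Fin N → ℝ => F (q, p')) p (Pi.single i 1) := by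
  have h1 : HasDerivAt (Function.update p i) (Pi.single i (1 : ℝ)) (p i) :=
    hasDerivAt_update p i (p i)
  have h2 : HasFDerivAt (fun p' : Fin N → ℝ => F (q, p'))
      (fderiv ℝ (fun p' : Fin N → ℝ => F (q, p')) p) (Function.update p i (p i)) := by
    rw [Function.update_eq_self]
    exact h.hasFDerivAt
  unfold partialP
  exact (h2.comp_hasDerivAt (p i) h1).deriv

/-- `∂_{p_i}` of the odd part `F_o(x) = (f(x) - f(Θx))/2`, `Θ(q,p) = (q,-p)`, of a differentiable `f`:
`∂_{p_i} F_o (x) = (∂_{p_i} f (x) + ∂_{p_i} f (Θx))/2` (the chain rule through `p ↦ -p` flips the sign of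
the second term). [folklore] -/
theorem partialP_oddPart {N : ℕ} {f Fo : PhaseSpace N → ℝ} (hf : Differentiable ℝ f)
    (hFo : ∀ x, Fo x = (f x - f (x.1, -x.2)) / 2) (i : Fin N) (x : PhaseSpace N) :
    partialP i Fo x = (partialP i f x + partialP i f (x.1, -x.2)) / 2 := by
  have hFo' : Fo = fun z => (f z - f (z.1, -z.2)) / 2 := funext hFo
  subst hFo'
  have hu : ∀ s, DifferentiableAt ℝ (Function.update x.2 i) s := fun s =>
    (hasDerivAt_update x.2 i s).differentiableAt
  have hd1 : DifferentiableAt ℝ (fun t => f (x.1, Function.update x.2 i t)) (x.2 i) :=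
    (hf _).comp (x.2 i) ((differentiableAt_const _).prodMk (hu _))
  have hd2 : DifferentiableAt ℝ (fun t => f (x.1, -Function.update x.2 i t)) (x.2 i) :=
    (hf _).comp (x.2 i) ((differentiableAt_const _).prodMk (hu _).fun_neg)
  have hB : deriv (fun t => f (x.1, -Function.update x.2 i t)) (x.2 i) =
      -deriv (fun s => f (x.1, Function.update (-x.2) i s)) ((-x.2) i) := by
    rw [show (fun t => f (x.1, -Function.update x.2 i t)) =
        fun t => f (x.1, Function.update (-x.2) i (-t)) from funext fun t => by rw [neg_update_eq]]
    exact deriv_comp_neg (fun s => f (x.1, Function.update (-x.2) i s)) (x.2 i)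
  unfold partialP
  dsimp only
  rw [deriv_div_const, deriv_fun_sub hd1 hd2, hB, sub_neg_eq_add]

/-! ### The odd Gaussian Poincaré inequality on a fibre -/

/-- For an even probability measure `γ` (`γ ∘ (y ↦ -y)⁻¹ = γ`) and an odd measurable `φ`:
`∫∫ (φ x - φ y)² dγ(y) dγ(x) = 2 ∫ φ² dγ` in `[0, ∞]` (flip `y ↦ -y` in the inner integral and average:
`(φx - φy)² + (φx + φy)² = 2φx² + 2φy²`). [folklore] -/
theorem lintegral_lintegral_sq_sub_of_odd {α : Type*} [MeasurableSpace α] [Neg α] [MeasurableNeg α]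
    (γ : Measure α) [IsProbabilityMeasure γ] (hγ : γ.map (fun y => -y) = γ)
    {φ : α → ℝ} (hφm : Measurable φ) (hodd : ∀ x, φ (-x) = -φ x) :
    ∫⁻ x, ∫⁻ y, ENNReal.ofReal ((φ x - φ y) ^ 2) ∂γ ∂γ = 2 * ∫⁻ x, ENNReal.ofReal (φ x ^ 2) ∂γ := by
  have hsq : Measurable fun y => ENNReal.ofReal (φ y ^ 2) := (hφm.pow_const 2).ennreal_ofReal
  have hin : ∀ x, 2 * ∫⁻ y, ENNReal.ofReal ((φ x - φ y) ^ 2) ∂γ =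
      2 * ENNReal.ofReal (φ x ^ 2) + 2 * ∫⁻ y, ENNReal.ofReal (φ y ^ 2) ∂γ := by
    intro x
    have hF : Measurable fun y => ENNReal.ofReal ((φ x - φ y) ^ 2) :=
      ((measurable_const.sub hφm).pow_const 2).ennreal_ofReal
    have hflip : ∫⁻ y, ENNReal.ofReal ((φ x - φ y) ^ 2) ∂γ =
        ∫⁻ y, ENNReal.ofReal ((φ x + φ y) ^ 2) ∂γ := by
      have h := lintegral_map (μ := γ) hF measurable_neg
      rw [hγ] at h
      rw [h]
      simp only [hodd, sub_neg_eq_add]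
    have e : ∀ y, ENNReal.ofReal ((φ x - φ y) ^ 2) + ENNReal.ofReal ((φ x + φ y) ^ 2) =
        2 * ENNReal.ofReal (φ x ^ 2) + 2 * ENNReal.ofReal (φ y ^ 2) := by
      intro y
      rw [← ENNReal.ofReal_add (sq_nonneg _) (sq_nonneg _),
        show (φ x - φ y) ^ 2 + (φ x + φ y) ^ 2 = 2 * φ x ^ 2 + 2 * φ y ^ 2 by ring,
        ENNReal.ofReal_add (by positivity) (by positivity), ENNReal.ofReal_mul zero_le_two,
        ENNReal.ofReal_mul zero_le_two, ENNReal.ofReal_ofNat]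
    calc 2 * ∫⁻ y, ENNReal.ofReal ((φ x - φ y) ^ 2) ∂γ
        = ∫⁻ y, ENNReal.ofReal ((φ x - φ y) ^ 2) ∂γ + ∫⁻ y, ENNReal.ofReal ((φ x + φ y) ^ 2) ∂γ := by
          rw [two_mul, ← hflip]
      _ = ∫⁻ y, (ENNReal.ofReal ((φ x - φ y) ^ 2) + ENNReal.ofReal ((φ x + φ y) ^ 2)) ∂γ :=
          (lintegral_add_left hF _).symm
      _ = ∫⁻ y, (2 * ENNReal.ofReal (φ x ^ 2) + 2 * ENNReal.ofReal (φ y ^ 2)) ∂γ :=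
          lintegral_congr e
      _ = 2 * ENNReal.ofReal (φ x ^ 2) + 2 * ∫⁻ y, ENNReal.ofReal (φ y ^ 2) ∂γ := by
          rw [lintegral_add_right _ (hsq.const_mul 2), lintegral_const, measure_univ, mul_one,
            lintegral_const_mul 2 hsq]
  have hout : 2 * ∫⁻ x, ∫⁻ y, ENNReal.ofReal ((φ x - φ y) ^ 2) ∂γ ∂γ =
      2 * (2 * ∫⁻ x, ENNReal.ofReal (φ x ^ 2) ∂γ) := by
    rw [← lintegral_const_mul' 2 _ ENNReal.ofNat_ne_top]
    simp_rw [hin]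
    rw [lintegral_add_right _ measurable_const, lintegral_const, measure_univ, mul_one,
      lintegral_const_mul 2 hsq, ← two_mul]
  exact (ENNReal.mul_right_inj two_ne_zero ENNReal.ofNat_ne_top).1 hout

/-- The product Gaussian `𝒩(0, v I_n)` is even: invariant under `y ↦ -y`. [folklore] -/
theorem pi_gaussianReal_map_neg (n : ℕ) (v : ℝ≥0) :
    (Measure.pi fun _ : Fin n => gaussianReal 0 v).map (fun y => -y) =
      Measure.pi fun _ : Fin n => gaussianReal 0 v := by
  have e : (fun y : Fin n → ℝ => -y) = fun y i => -(y i) := rfl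
  rw [e, Measure.pi_map_pi (f := fun (_ : Fin n) (t : ℝ) => -t) fun _ => measurable_neg.aemeasurable]
  simp only [gaussianReal_map_neg, neg_zero]

/-- **Gaussian Poincaré inequality for odd functions, Lebesgue-density form.** For `T > 0` and an odd
`φ ∈ C¹(ℝ^n)`:
`∫ e^{-|p|²/2T} φ(p)² dp ≤ 2T ∫ e^{-|p|²/2T} ∑_i (∂_i φ(p))² dp` (in `[0, ∞]`). From the interpolation form
`∫∫ (φ x - φ y)² dγdγ ≤ (π²/4) T ∫ |∇φ|² dγ` for `γ = 𝒩(0, T I_n)` (tree, `lintegral_sq_sub_le_pi_gaussianReal`),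
the odd identity `∫∫ (φ x - φ y)² = 2∫ φ²`, `γ = (2πT)^{-n/2} e^{-|p|²/2T} dp` and `π²/8 ≤ 2`. [folklore] -/
theorem lintegral_sq_gaussianWeight_le_of_odd {n : ℕ} {T : ℝ} (hT : 0 < T)
    {φ : (Fin n → ℝ) → ℝ} (hφ : ContDiff ℝ 1 φ) (hodd : ∀ x, φ (-x) = -φ x) :
    ∫⁻ p, ENNReal.ofReal (Real.exp (-(∑ i, p i ^ 2 / 2) / T)) * ENNReal.ofReal (φ p ^ 2) ≤
      ENNReal.ofReal (2 * T) * ∫⁻ p, ENNReal.ofReal (Real.exp (-(∑ i, p i ^ 2 / 2) / T)) *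
        ENNReal.ofReal (∑ i, (fderiv ℝ φ p (Pi.single i 1)) ^ 2) := by
  obtain ⟨v, rfl⟩ : ∃ v : ℝ≥0, (v : ℝ) = T := ⟨⟨T, hT.le⟩, rfl⟩
  have hv0 : v ≠ 0 := by
    rintro rfl
    simp at hT
  have hGm : Measurable fun w : Fin n → ℝ => ENNReal.ofReal (Real.exp (-(∑ i, w i ^ 2 / 2) / (v : ℝ))) := by
    fun_prop
  have hm1 : Measurable fun x : Fin n → ℝ => ENNReal.ofReal (φ x ^ 2) :=
    (hφ.continuous.pow 2).measurable.ennreal_ofReal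
  have hm2 : Measurable fun x : Fin n → ℝ => ENNReal.ofReal (∑ i, (fderiv ℝ φ x (Pi.single i 1)) ^ 2) :=
    (continuous_finsetSum _ fun i _ =>
      ((hφ.continuous_fderiv one_ne_zero).clm_apply continuous_const).pow 2).measurable.ennreal_ofReal
  have key := lintegral_sq_sub_le_pi_gaussianReal v hφ
  rw [lintegral_lintegral_sq_sub_of_odd _ (pi_gaussianReal_map_neg n v) hφ.continuous.measurable hodd,
    pi_gaussianReal_eq_smul_withDensity n hv0, lintegral_smul_measure, lintegral_smul_measure,
    lintegral_withDensity_eq_lintegral_mul _ hGm hm1, lintegral_withDensity_eq_lintegral_mul _ hGm hm2] at key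
  simp only [Pi.mul_apply, smul_eq_mul] at key
  have hc0 : ENNReal.ofReal ((Real.sqrt (2 * Real.pi * (v : ℝ)))⁻¹ ^ n) ≠ 0 :=
    (ENNReal.ofReal_pos.2 (by positivity)).ne'
  have hpi : Real.pi ^ 2 / 4 * (v : ℝ) ≤ 2 * (2 * (v : ℝ)) := by
    have h16 : Real.pi ^ 2 ≤ 16 := by
      have h4 := Real.pi_le_four
      have h0 := Real.pi_pos.le
      nlinarith
    nlinarith [mul_nonneg (sub_nonneg.2 h16) hT.le]
  refine (ENNReal.mul_le_mul_iff_right hc0 ENNReal.ofReal_ne_top).1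
    ((ENNReal.mul_le_mul_iff_right two_ne_zero ENNReal.ofNat_ne_top).1 (key.trans ?_))
  calc ENNReal.ofReal (Real.pi ^ 2 / 4 * (v : ℝ)) *
        (ENNReal.ofReal ((Real.sqrt (2 * Real.pi * (v : ℝ)))⁻¹ ^ n) *
          ∫⁻ a, ENNReal.ofReal (Real.exp (-(∑ i, a i ^ 2 / 2) / (v : ℝ))) *
            ENNReal.ofReal (∑ i, (fderiv ℝ φ a (Pi.single i 1)) ^ 2))
      ≤ ENNReal.ofReal (2 * (2 * (v : ℝ))) *
        (ENNReal.ofReal ((Real.sqrt (2 * Real.pi * (v : ℝ)))⁻¹ ^ n) *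
          ∫⁻ a, ENNReal.ofReal (Real.exp (-(∑ i, a i ^ 2 / 2) / (v : ℝ))) *
            ENNReal.ofReal (∑ i, (fderiv ℝ φ a (Pi.single i 1)) ^ 2)) :=
        mul_le_mul' (ENNReal.ofReal_le_ofReal hpi) le_rfl
    _ = 2 * (ENNReal.ofReal ((Real.sqrt (2 * Real.pi * (v : ℝ)))⁻¹ ^ n) *
          (ENNReal.ofReal (2 * (v : ℝ)) *
            ∫⁻ a, ENNReal.ofReal (Real.exp (-(∑ i, a i ^ 2 / 2) / (v : ℝ))) *
              ENNReal.ofReal (∑ i, (fderiv ℝ φ a (Pi.single i 1)) ^ 2))) := by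
        rw [ENNReal.ofReal_mul zero_le_two, ENNReal.ofReal_ofNat]
        ring

/-! ### Flip invariance of the Gibbs measure -/

/-- Momentum-flip invariance of the Gibbs measure at the level of Lebesgue integrals:
`∫⁻ G(q,-p) dμ_T = ∫⁻ G dμ_T` for every `G : phase space → [0, ∞]` (`H` is even in `p`,
`hamiltonian_neg_momentum`, and Lebesgue measure is flip-invariant, `measurePreserving_momentumReversal`; in the
non-integrable case `μ_T = 0`). [folklore] -/
theorem lintegral_comp_flip_gibbsMeasure (P : OscillatorChain) (N : ℕ) (T : ℝ)
    (G : PhaseSpace N → ℝ≥0∞) :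
    ∫⁻ x, G (x.1, -x.2) ∂(P.gibbsMeasure N T) = ∫⁻ x, G x ∂(P.gibbsMeasure N T) := by
  rw [P.gibbsMeasure_eq, lintegral_tilted, lintegral_tilted]
  conv_rhs => rw [← (measurePreserving_momentumReversal N).lintegral_comp_emb
    (momentumReversal N).measurableEmbedding]
  simp only [momentumReversal_apply, OscillatorChain.hamiltonian_neg_momentum]

/-! ### The registered sub-goal -/

/-- **Fibrewise Gaussian Poincaré inequality for the odd part** (registered sub-goal `oddFibrePoincare` of
crux `ExtensiveSnapshotIrreversibility`, line `clausius-budget-sound-window`). For every oscillator chain `Q`,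
`N`, `T > 0` and `f ∈ C¹` with `f, ∂_{p_i} f ∈ L²(μ_T)`, `μ_T = Q.gibbsMeasure N T`:
`∫ ((f(x) - f(q,-p))/2)² dμ_T ≤ 2T ∑_i ∫ ((∂_{p_i}f(x) + ∂_{p_i}f(q,-p))/2)² dμ_T`, i.e.
`‖f_o‖² ≤ 2T ∑_i ‖∂_{p_i} f_o‖²` for the odd part `f_o`. Proof: under `μ_T` the momenta are, given `q`,
Gaussian `𝒩(0, T I_N)` (`H = ∑p²/2 + Φ(q)`, `lintegral_tilted`, Tonelli), `p ↦ f_o(q,p)` is odd and `C¹`, so the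
odd Gaussian Poincaré inequality `lintegral_sq_gaussianWeight_le_of_odd` (constant `π²/8 · T ≤ 2T`, from the
tree's `lintegral_sq_sub_le_pi_gaussianReal`) applies fibre by fibre with
`∂_i (p ↦ f_o(q,p)) = (∂_{p_i}f + ∂_{p_i}f∘Θ)/2` (`partialP_eq_fderiv_fibre`, `partialP_oddPart`); the `L²`
hypothesis and flip invariance make the right side finite; for non-integrable `e^{-H/T}` both sides vanish.
[folklore] (Gaussian Poincaré: Pisier's rotation argument; fibrewise use as in Villani, *Hypocoercivity*, 2009, §7) -/
theorem oddFibrePoincare :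
    ∀ (Q : OscillatorChain) (N : ℕ) (T : ℝ), 0 < T → ∀ f : PhaseSpace N → ℝ,
          ContDiff ℝ 1 f → MemLp f 2 (Q.gibbsMeasure N T) → (∀ i : Fin N, MemLp (fun x => partialP i f x) 2 (Q.gibbsMeasure N T)) →
          ∫ x, ((f x - f (x.1, -x.2)) / 2) ^ 2 ∂(Q.gibbsMeasure N T) ≤
            2 * T * ∑ i : Fin N, ∫ x, ((partialP i f x + partialP i f (x.1, -x.2)) / 2) ^ 2 ∂(Q.gibbsMeasure N T) := by
  intro Q N T hT f hf _ hgrad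
  -- the non-integrable case: `μ_T = 0`
  by_cases hint : Integrable (Q.gibbsDensity N T)
  swap
  · rw [Q.gibbsMeasure_of_not_integrable hint]
    simp
  -- opaque abbreviations for the odd part and its momentum gradient
  obtain ⟨Fo, hFo⟩ : ∃ Fo : PhaseSpace N → ℝ, ∀ x, Fo x = (f x - f (x.1, -x.2)) / 2 := ⟨_, fun _ => rfl⟩
  obtain ⟨g, hg⟩ : ∃ g : Fin N → PhaseSpace N → ℝ,
      ∀ i x, g i x = (partialP i f x + partialP i f (x.1, -x.2)) / 2 := ⟨_, fun _ _ => rfl⟩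
  simp_rw [← hFo, ← hg]
  -- regularity
  have hfd : Differentiable ℝ f := hf.differentiable one_ne_zero
  have hΘ : ContDiff ℝ 1 fun x : PhaseSpace N => ((x.1, -x.2) : PhaseSpace N) :=
    contDiff_fst.prodMk contDiff_snd.neg
  have hFoC : ContDiff ℝ 1 Fo := by
    rw [show Fo = fun x => (f x - f (x.1, -x.2)) / 2 from funext hFo]
    exact (hf.sub (hf.comp hΘ)).div_const 2
  have hFoc : Continuous Fo := hFoC.continuous
  have hPc : ∀ i, Continuous (partialP i f) := fun i => continuous_partialP hf one_ne_zero i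
  have hgc : ∀ i, Continuous (g i) := fun i => by
    rw [show g i = fun x => (partialP i f x + partialP i f (x.1, -x.2)) / 2 from funext (hg i)]
    exact ((hPc i).add ((hPc i).comp hΘ.continuous)).div_const 2
  -- the fibre functions `p ↦ Fo (q, p)`: `C¹`, odd, with gradient `g · (q, ·)`
  have hφ : ∀ q : Fin N → ℝ, ContDiff ℝ 1 fun p : Fin N → ℝ => Fo (q, p) := fun q =>
    hFoC.comp (contDiff_prodMk_right q)
  have hodd : ∀ q p : Fin N → ℝ, Fo (q, -p) = -Fo (q, p) := fun q p => by
    rw [hFo, hFo]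
    simp only [neg_neg]
    ring
  have hder : ∀ (q p : Fin N → ℝ) (i : Fin N),
      fderiv ℝ (fun p' : Fin N → ℝ => Fo (q, p')) p (Pi.single i 1) = g i (q, p) := by
    intro q p i
    rw [← partialP_eq_fderiv_fibre Fo q p i (((hφ q).differentiable one_ne_zero) p),
      partialP_oddPart hfd hFo i (q, p), hg]
  have hfibre : ∀ q : Fin N → ℝ,
      ∫⁻ p, ENNReal.ofReal (Real.exp (-(∑ i, p i ^ 2 / 2) / T)) * ENNReal.ofReal (Fo (q, p) ^ 2) ≤
        ENNReal.ofReal (2 * T) * ∫⁻ p, ENNReal.ofReal (Real.exp (-(∑ i, p i ^ 2 / 2) / T)) *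
          ENNReal.ofReal (∑ i, g i (q, p) ^ 2) := by
    intro q
    have h := lintegral_sq_gaussianWeight_le_of_odd hT (hφ q) (hodd q)
    simp only [hder] at h
    exact h
  -- measurability of the factorised weight `e^{-Φ(q)/T} · e^{-|p|²/2T}`
  have hGm : Measurable fun p : Fin N → ℝ => ENNReal.ofReal (Real.exp (-(∑ i, p i ^ 2 / 2) / T)) := by
    fun_prop
  have heM : AEMeasurable (fun x : PhaseSpace N => ENNReal.ofReal (Real.exp (-Q.potential N x.1 / T)))
      ((volume : Measure (Fin N → ℝ)).prod volume) := by
    have e : (fun x : PhaseSpace N => ENNReal.ofReal (Real.exp (-Q.potential N x.1 / T))) =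
        fun x => ENNReal.ofReal (Q.gibbsDensity N T x * Real.exp ((∑ i, x.2 i ^ 2 / 2) / T)) := by
      funext x
      rw [OscillatorChain.gibbsDensity, ← Real.exp_add, Q.hamiltonian_eq_kinetic_add_potential]
      congr 2
      ring
    rw [e, ← Measure.volume_eq_prod]
    exact (hint.aemeasurable.mul (by fun_prop : Measurable fun x : PhaseSpace N =>
      Real.exp ((∑ i, x.2 i ^ 2 / 2) / T)).aemeasurable).ennreal_ofReal
  have hXm : AEMeasurable (fun x : PhaseSpace N => ENNReal.ofReal (Real.exp (-Q.potential N x.1 / T)) *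
      (ENNReal.ofReal (Real.exp (-(∑ i, x.2 i ^ 2 / 2) / T)) * ENNReal.ofReal (Fo x ^ 2)))
      ((volume : Measure (Fin N → ℝ)).prod volume) :=
    heM.mul ((hGm.comp measurable_snd).mul (hFoc.pow 2).measurable.ennreal_ofReal).aemeasurable
  have hYm : AEMeasurable (fun x : PhaseSpace N => ENNReal.ofReal (Real.exp (-Q.potential N x.1 / T)) *
      (ENNReal.ofReal (Real.exp (-(∑ i, x.2 i ^ 2 / 2) / T)) * ENNReal.ofReal (∑ i, g i x ^ 2)))
      ((volume : Measure (Fin N → ℝ)).prod volume) :=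
    heM.mul ((hGm.comp measurable_snd).mul (continuous_finsetSum _ fun i _ =>
      (hgc i).pow 2).measurable.ennreal_ofReal).aemeasurable
  -- the inequality in `ℝ≥0∞` under `μ_T`: factorise the weight, Tonelli, fibrewise Poincaré
  have core : ∫⁻ x, ENNReal.ofReal (Fo x ^ 2) ∂(Q.gibbsMeasure N T) ≤
      ENNReal.ofReal (2 * T) * ∫⁻ x, ENNReal.ofReal (∑ i, g i x ^ 2) ∂(Q.gibbsMeasure N T) := by
    have hw : ∀ (c : ℝ) (x : PhaseSpace N), ENNReal.ofReal (Real.exp (-Q.hamiltonian N x / T) / c) =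
        ENNReal.ofReal c⁻¹ * (ENNReal.ofReal (Real.exp (-Q.potential N x.1 / T)) *
          ENNReal.ofReal (Real.exp (-(∑ i, x.2 i ^ 2 / 2) / T))) := by
      intro c x
      have hsplit : Real.exp (-Q.hamiltonian N x / T) =
          Real.exp (-Q.potential N x.1 / T) * Real.exp (-(∑ i, x.2 i ^ 2 / 2) / T) := by
        rw [← Real.exp_add, Q.hamiltonian_eq_kinetic_add_potential]
        congr 1
        ring
      rw [hsplit, div_eq_mul_inv _ c, mul_comm _ c⁻¹, ENNReal.ofReal_mul' (by positivity),
        ENNReal.ofReal_mul (Real.exp_pos _).le]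
    rw [Q.gibbsMeasure_eq, lintegral_tilted, lintegral_tilted]
    simp_rw [hw, mul_assoc]
    rw [lintegral_const_mul' _ _ ENNReal.ofReal_ne_top, lintegral_const_mul' _ _ ENNReal.ofReal_ne_top,
      mul_left_comm (ENNReal.ofReal (2 * T))]
    gcongr
    rw [Measure.volume_eq_prod, lintegral_prod _ hXm, lintegral_prod _ hYm]
    dsimp only
    simp_rw [lintegral_const_mul' _ _ ENNReal.ofReal_ne_top]
    rw [← lintegral_const_mul' (ENNReal.ofReal (2 * T)) _ ENNReal.ofReal_ne_top]
    refine lintegral_mono fun q => ?_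
    rw [mul_left_comm]
    exact mul_le_mul' le_rfl (hfibre q)
  -- finiteness of the right-hand side: `g i ∈ L²(μ_T)`
  have hbL2 : ∀ i, Integrable (fun x => partialP i f (x.1, -x.2) ^ 2) (Q.gibbsMeasure N T) := by
    intro i
    refine ⟨(((hPc i).comp hΘ.continuous).pow 2).aestronglyMeasurable, ?_⟩
    have hfin := (hgrad i).integrable_sq.hasFiniteIntegral
    rw [hasFiniteIntegral_iff_ofReal (ae_of_all _ fun x => sq_nonneg _)] at hfin ⊢
    rwa [lintegral_comp_flip_gibbsMeasure Q N T fun x => ENNReal.ofReal (partialP i f x ^ 2)]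
  have hgL2 : ∀ i, MemLp (g i) 2 (Q.gibbsMeasure N T) := by
    intro i
    have h1 : MemLp (fun x => partialP i f (x.1, -x.2)) 2 (Q.gibbsMeasure N T) :=
      (memLp_two_iff_integrable_sq ((hPc i).comp hΘ.continuous).aestronglyMeasurable).2 (hbL2 i)
    rw [show g i = fun x => (partialP i f x + partialP i f (x.1, -x.2)) * 2⁻¹ from
      funext fun x => by rw [hg, div_eq_mul_inv]]
    exact ((hgrad i).add h1).mul_const _
  have hBi : ∀ i, ∫⁻ x, ENNReal.ofReal (g i x ^ 2) ∂(Q.gibbsMeasure N T) ≠ ⊤ := fun i =>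
    ((hgL2 i).integrable_sq.lintegral_lt_top).ne
  have hsum : ∫⁻ x, ENNReal.ofReal (∑ i, g i x ^ 2) ∂(Q.gibbsMeasure N T) =
      ∑ i, ∫⁻ x, ENNReal.ofReal (g i x ^ 2) ∂(Q.gibbsMeasure N T) := by
    rw [← lintegral_finsetSum (μ := Q.gibbsMeasure N T) Finset.univ
      (f := fun i x => ENNReal.ofReal (g i x ^ 2)) fun i _ => ((hgc i).pow 2).measurable.ennreal_ofReal]
    exact lintegral_congr fun x => ENNReal.ofReal_sum_of_nonneg fun i _ => sq_nonneg _
  -- back to Bochner integrals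
  rw [integral_eq_lintegral_of_nonneg_ae (ae_of_all _ fun x => sq_nonneg (Fo x))
    (hFoc.pow 2).aestronglyMeasurable]
  have eBi : ∀ i, ∫ x, g i x ^ 2 ∂(Q.gibbsMeasure N T) =
      (∫⁻ x, ENNReal.ofReal (g i x ^ 2) ∂(Q.gibbsMeasure N T)).toReal := fun i =>
    integral_eq_lintegral_of_nonneg_ae (ae_of_all _ fun x => sq_nonneg (g i x))
      ((hgc i).pow 2).aestronglyMeasurable
  simp_rw [eBi]
  rw [← ENNReal.toReal_sum fun i _ => hBi i, ← ENNReal.toReal_ofReal (by positivity : (0 : ℝ) ≤ 2 * T),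
    ← ENNReal.toReal_mul]
  refine ENNReal.toReal_mono (ENNReal.mul_ne_top ENNReal.ofReal_ne_top
    (ENNReal.sum_ne_top.2 fun i _ => hBi i)) ?_
  rw [← hsum]
  exact core

end Summit.AtomisticToContinuum.FouriersLaw.Theorems.ExtensiveSnapshotIrreversibility.ClausiusBudget

end
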